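import Summits.FinalStateConjecture.FinalStateConjecture.Theorems.BartnikGapSettlingGapExhaustionIKLocalStepOutOfConstants
import Summits.FinalStateConjecture.FinalStateConjecture.Theorems.BartnikGapSettlingGapExhaustionMultiplierBeyondShellUniform
import Summits.FinalStateConjecture.FinalStateConjecture.Theorems.BartnikGapSettlingGapExhaustionKerrBandHigherRegularityUniform
import Summits.FinalStateConjecture.FinalStateConjecture.Theorems.BartnikGapSettlingGapExhaustionIKStepFrameUniform
import HarnessLib

/-!
# Crux `GapExhaustion` (stmt-FinalStateConjecture-10808), line `photon-shell-pseudoconvexity`: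
# stub (UN-6-out) `stub_ikLocalStepOutU` — the local extension step of the INWARD sweep, UNIFORMLY
# over a compact set of subextremal labels

Route `BartnikGapSettling`; helper (`--supports stmt-FinalStateConjecture-10808`) of line lead
c11 (label-uniformity wave 3, S3, composition). The registered inward Killing sweep S3
quantifies its order and tolerance `∃ k δ` BEFORE the Kerr label `(M, a)`, over the compact label
window `[m₀, m₀⁻¹] × {|a| ≤ χM}`; the landed per-label outer local step `stub_ikLocalStepOut`
(`BartnikGapSettlingGapExhaustionIKLocalStepOut.lean`) gives `δ` and `ρ ↦ ρ'` per label. This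
file makes both UNIFORM over any compact `K ⊆ {0 < M, |a| < M}` of labels with band radii
`r_lo`, `r_e` continuous on `K`, `r_ph⁻(ℓ) < r_lo(ℓ) < r_e(ℓ)`, by composing

* (V-6-out) `ikLocalStepOut_of_constants` — the per-label outer step with the constants
  quantified first and the three brick conclusions as hypotheses;
* (UU-out) `stub_kerrMultiplierBeyondShellU` — ONE `(δU, ε₁)` for the outer multiplier form
  beyond the shell over `K`;
* (UN-2) `stub_kerrBandHigherRegularityU` at order `6` — ONE `(ρ₀, L₃, ν, CK)` over `K`;
* (UN-6a) `stub_ikFrameNormalisationU` — ONE exact-frame tolerance `δF` (label-free).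

Ionescu–Klainerman's local extension theorem (JAMS 26 (2013), Thm 1.2 with Lemmas 2.10–2.11,
chart form) is the explicit hypothesis `hIK`, exactly as in the model.
-/

noncomputable section

set_option maxSynthPendingDepth 3

-- D-0017: single-problem summit, `Summit.<S>.<S>.…` by design (cf. lakefile `weak.linter.dupNamespace`).
set_option linter.dupNamespace false

namespace Summit.FinalStateConjecture.FinalStateConjecture.Theorems

open Set Function Metric
open Literature.Geometry.Lorentzian Literature.Geometry.Lorentzian.MetricCoord
open scoped Manifold ContDiff Topology ENNReal

/-- **Stub (UN-6-out) — the local step of the INWARD sweep, UNIFORMLY over a compact set of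
labels, from Ionescu–Klainerman's local extension theorem (chart form, the hypothesis `hIK`).**
For a compact `K ⊆ {(M, a) | 0 < M, |a| < M}` and band radii `r_lo`, `r_e` continuous on `K`
with `r_ph⁻(ℓ) = photonOrbitRadius ℓ.1 |ℓ.2| < r_lo(ℓ) < r_e(ℓ)` there is ONE tolerance
`δ > 0`, and for every input radius `ρ > 0` ONE output radius `ρ' > 0`, such that for every label
`ℓ ∈ K`, every Ricci-flat spacetime `𝓢` and every chart `Φ : E4 → 𝓢` smooth and openly embedded
on the star domain `{r > ℓ.1}` with injective differential, whose components are `δ`-close to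
`g_ℓ` in `C⁶` on `{(r₊ + r_lo)/2 ≤ r ≤ r_e + 1}`, a `C^∞` solution of the coordinate Killing
equation on `ball x ρ ∩ {c < r}` (`r x = c ∈ [r_lo ℓ, r_e ℓ]`) extends to one on `ball x ρ'`,
agreeing beyond the cylinder. Composition of (V-6-out), (UU-out), (UN-2), (UN-6a).
[cite: IonescuKlainerman2013, Thm 1.2, Lemma 2.10, Lemma 2.11] -/
theorem stub_ikLocalStepOutU :
    (∀ (A A₁ δ₀ : ℝ), 1 ≤ A → A ≤ A₁ → 0 < δ₀ → δ₀ ≤ 1 → ∃ δ₁ : ℝ, 0 < δ₁ ∧ δ₁ ≤ δ₀ ∧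
      ∀ (G : E4 → E4 →L[ℝ] E4 →L[ℝ] ℝ) (f : E4 → ℝ) (p : E4) (Z : E4 → E4),
        MetricCoord.IsMetricOn G (Metric.ball p 1) →
        (∀ x ∈ Metric.ball p 1, MetricCoord.ricAt G x = 0) →
        G p = Minkowski.bilin →
        ContDiffOn ℝ ∞ f (Metric.ball p 1) →
        (∀ x ∈ Metric.ball p 1,
          (∑ j ∈ Finset.Icc 1 6, ‖iteratedFDeriv ℝ j G x‖) +
            (∑ j ∈ Finset.Icc 1 4, ‖iteratedFDeriv ℝ j f x‖) ≤ A) →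
        f p = 0 → A₁⁻¹ ≤ ‖fderiv ℝ f p‖ →
        (∃ μ ∈ Icc (-A₁) A₁, ∀ X : E4,
          A₁⁻¹ * ‖X‖ ^ 2 ≤ μ * G p X X - MetricCoord.hessAt G f p X X + A₁ * (fderiv ℝ f p X) ^ 2) →
        ContDiffOn ℝ ∞ Z (Metric.ball p δ₀ ∩ {x | f x < 0}) →
        (∀ x ∈ Metric.ball p δ₀ ∩ {x | f x < 0}, ∀ Y W : E4,
          fderiv ℝ G x (Z x) Y W + G x (fderiv ℝ Z x Y) W + G x Y (fderiv ℝ Z x W) = 0) →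
        ∃ Z' : E4 → E4, ContDiffOn ℝ ∞ Z' (Metric.ball p δ₁) ∧
          (∀ x ∈ Metric.ball p δ₁, ∀ Y W : E4,
            fderiv ℝ G x (Z' x) Y W + G x (fderiv ℝ Z' x Y) W + G x Y (fderiv ℝ Z' x W) = 0) ∧
          EqOn Z' Z (Metric.ball p δ₁ ∩ {x | f x < 0})) →
    ∀ (K : Set (ℝ × ℝ)) (r_lo r_e : ℝ × ℝ → ℝ), IsCompact K →
      (∀ ℓ ∈ K, 0 < ℓ.1 ∧ |ℓ.2| < ℓ.1) → ContinuousOn r_lo K → ContinuousOn r_e K →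
      (∀ ℓ ∈ K, Kerr.photonOrbitRadius ℓ.1 |ℓ.2| < r_lo ℓ ∧ r_lo ℓ < r_e ℓ) →
      ∃ δ : ℝ, 0 < δ ∧ ∀ ρ : ℝ, 0 < ρ → ∃ ρ' : ℝ, 0 < ρ' ∧ ∀ ℓ ∈ K,
      ∀ (𝓢 : Spacetime.{0} 4) [𝓢.metric.HasLeviCivita] (Φ : E4 → 𝓢.carrier),
        𝓢.metric.toPseudoRiemannianMetric.IsRicciFlat →
        ContMDiffOn 𝓘(ℝ, E4) (𝓡 4) ∞ Φ {z | ℓ.1 < Kerr.radius ℓ.2 z} →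
        Topology.IsOpenEmbedding ({z : E4 | ℓ.1 < Kerr.radius ℓ.2 z}.restrict Φ) →
        (∀ z : E4, ℓ.1 < Kerr.radius ℓ.2 z → Function.Injective (mfderiv 𝓘(ℝ, E4) (𝓡 4) Φ z)) →
        (∀ z : E4, (Kerr.rPlus ℓ.1 ℓ.2 + r_lo ℓ) / 2 ≤ Kerr.radius ℓ.2 z → Kerr.radius ℓ.2 z ≤ r_e ℓ + 1 →
          ∀ j : ℕ, j ≤ 6 →
            ‖iteratedFDeriv ℝ j (fun z => 𝓢.metricInCoords Φ z - Kerr.bilin ℓ.1 ℓ.2 z) z‖ ≤ δ) →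
        ∀ c ∈ Icc (r_lo ℓ) (r_e ℓ), ∀ x : E4, Kerr.radius ℓ.2 x = c → ∀ k : E4 → E4,
          ContDiffOn ℝ ∞ k (ball x ρ ∩ {y | c < Kerr.radius ℓ.2 y}) →
          (∀ y ∈ ball x ρ ∩ {y | c < Kerr.radius ℓ.2 y}, ∀ Y Z : E4,
            fderiv ℝ (𝓢.metricInCoords Φ) y (k y) Y Z + 𝓢.metricInCoords Φ y (fderiv ℝ k y Y) Z
              + 𝓢.metricInCoords Φ y Y (fderiv ℝ k y Z) = 0) →
          ∃ k' : E4 → E4, ContDiffOn ℝ ∞ k' (ball x ρ') ∧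
            (∀ y ∈ ball x ρ', ∀ Y Z : E4,
              fderiv ℝ (𝓢.metricInCoords Φ) y (k' y) Y Z + 𝓢.metricInCoords Φ y (fderiv ℝ k' y Y) Z
                + 𝓢.metricInCoords Φ y Y (fderiv ℝ k' y Z) = 0) ∧
            EqOn k' k (ball x ρ' ∩ {y | c < Kerr.radius ℓ.2 y}) := by
  intro hIK K r_lo r_e hK hlab hloc hrec hband
  -- (UU-out): ONE outer multiplier-form pair `(δU, ε₁)` over `K`
  obtain ⟨δU, ε₁, hδU, hε₁, hU⟩ := stub_kerrMultiplierBeyondShellU K r_lo r_e hK hlab hloc hrec hband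
  -- `r₊(ℓ) ≤ 2 ℓ.1 < 3 ℓ.1 ≤ r_ph⁻(ℓ) < r_lo ℓ`
  have hrp : ∀ ℓ ∈ K, Kerr.rPlus ℓ.1 ℓ.2 < r_lo ℓ := by
    intro ℓ hℓ
    have hM : 0 < ℓ.1 := (hlab ℓ hℓ).1
    have h3 : 3 * ℓ.1 ≤ Kerr.photonOrbitRadius ℓ.1 |ℓ.2| :=
      (Kerr.photonOrbitRadius_mem hM (abs_nonneg _)).1
    have hsq : √(ℓ.1 ^ 2 - ℓ.2 ^ 2) ≤ ℓ.1 := by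
      refine Real.sqrt_le_iff.2 ⟨hM.le, ?_⟩
      nlinarith [sq_nonneg ℓ.2]
    have hrp2 : Kerr.rPlus ℓ.1 ℓ.2 ≤ 2 * ℓ.1 := by
      unfold Kerr.rPlus; linarith
    linarith [(hband ℓ hℓ).1]
  -- (UN-2) at order 6: ONE tube / Lipschitz / `C⁶` constant set `(ρ₀, L₃, ν, CK)` over `K`
  obtain ⟨ρ₀, L₃, ν, CK, hρ₀, hL₃, hν, hCK, hbandU⟩ :=
    stub_kerrBandHigherRegularityU K r_lo r_e 6 hK hlab hloc hrec
      fun ℓ hℓ ↦ ⟨hrp ℓ hℓ, (hband ℓ hℓ).2.le⟩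
  -- (UN-6a): ONE exact-frame tolerance `δF`
  obtain ⟨δF, hδF, hF⟩ := stub_ikFrameNormalisationU
  refine ⟨min 1 (min δU δF), lt_min one_pos (lt_min hδU hδF), fun ρ hρ ↦ ?_⟩
  -- (V-6-out): the per-label outer step with these constants
  obtain ⟨ρ', hρ', H⟩ :=
    ikLocalStepOut_of_constants hIK δU ε₁ ρ₀ L₃ ν CK δF hδU hε₁ hρ₀ hL₃ hν hCK hδF ρ hρ
  refine ⟨ρ', hρ', fun ℓ hℓ 𝓢 _ Φ hRF hΦ hemb hinjd hclose ↦ ?_⟩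
  exact H ℓ.1 ℓ.2 (r_lo ℓ) (r_e ℓ) (hlab ℓ hℓ).1 (hlab ℓ hℓ).2 (hrp ℓ hℓ) (hband ℓ hℓ).1
    (hband ℓ hℓ).2 (hU ℓ hℓ) (hbandU ℓ hℓ) (hF ℓ.1 ℓ.2 (hlab ℓ hℓ).1) 𝓢 Φ hRF hΦ hemb hinjd hclose

end Summit.FinalStateConjecture.FinalStateConjecture.Theorems

end
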